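import Mathlib.Algebra.MvPolynomial.PDeriv
import Summits.Schanuel.Schanuel.Theorems.ZilberEacComplexGraphEscapeLemmas
import HarnessLib

/-!
# Second-order expansion of a polynomial along a complex ray

Auxiliary estimates for `ZilberEacComplexHypersurfaceEscape.lean` (Exponential-Algebraic Closedness over
an ARBITRARY hypersurface base by linear escape; first open rung `dim π₁(V) = n - 1`, Mantova–Masser,
PLMS 129 (2024), §1 p. 5):

* `exists_norm_eval_taylor_two_le` — second-order increments:
  `‖p(a + u) - p(a) - Σⱼ uⱼ (∂ⱼp)(a)‖ ≤ C ‖u‖² (1 + ‖a‖)ᴺ (1 + ‖u‖)ᴺ`;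
* `exists_norm_eval_ray_secondOrder_le` — **second-order expansion along a complex ray**: for `H` of
  total degree `D ≥ 1` with homogeneous components `H_D`, `H_{D-1}`:
  `‖H(τv + u) - τᴰ H_D(v) - τ^{D-1} (Σⱼ uⱼ (∂ⱼH_D)(v) + H_{D-1}(v))‖ ≤ C (1 + ‖u‖)ᴺ ‖τ‖^{D-1} / ‖τ‖`
  for `‖τ‖ ≥ 1` (complex-ray form of D'Aquino–Fornasiero–Terzo 2018, Lemma 2.3, one order further).

HONEST FRAMING: auxiliary estimates for a modest sub-rung of EAC; nothing bears on Schanuel's conjecture.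
-/

noncomputable section

open Complex MvPolynomial Metric Set Filter Topology

set_option linter.dupNamespace false

namespace Summit.Schanuel.Schanuel.Theorems

/-- **Second-order increment bound for polynomials.** For `p ∈ ℂ[x₁..xₙ]` there are `C ≥ 0`, `N`
with `‖p(a + u) - p(a) - Σⱼ uⱼ (∂ⱼ p)(a)‖ ≤ C ‖u‖² (1 + ‖a‖)ᴺ (1 + ‖u‖)ᴺ` (sup norm); induction on `p`,
the step `p ↦ p·Xᵢ` using the Leibniz rule and the first-order bound
`exists_norm_eval_add_sub_eval_le`. [folklore] -/
theorem exists_norm_eval_taylor_two_le {n : ℕ} (p : MvPolynomial (Fin n) ℂ) :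
    ∃ C : ℝ, 0 ≤ C ∧ ∃ N : ℕ, ∀ a u : Fin n → ℂ,
      ‖eval (a + u) p - eval a p - ∑ j, u j * eval a (pderiv j p)‖ ≤
        C * ‖u‖ ^ 2 * (1 + ‖a‖) ^ N * (1 + ‖u‖) ^ N := by
  classical
  induction p using MvPolynomial.induction_on with
  | C c => exact ⟨0, le_rfl, 0, fun a u => by simp⟩
  | add p q hp hq =>
    obtain ⟨C₁, hC₁, N₁, h₁⟩ := hp
    obtain ⟨C₂, hC₂, N₂, h₂⟩ := hq
    refine ⟨C₁ + C₂, add_nonneg hC₁ hC₂, max N₁ N₂, fun a u => ?_⟩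
    have ha : 1 ≤ 1 + ‖a‖ := le_add_of_nonneg_right (norm_nonneg _)
    have hu : 1 ≤ 1 + ‖u‖ := le_add_of_nonneg_right (norm_nonneg _)
    have key : ∀ {C : ℝ} {N : ℕ}, 0 ≤ C → N ≤ max N₁ N₂ →
        C * ‖u‖ ^ 2 * (1 + ‖a‖) ^ N * (1 + ‖u‖) ^ N ≤
          C * ‖u‖ ^ 2 * (1 + ‖a‖) ^ max N₁ N₂ * (1 + ‖u‖) ^ max N₁ N₂ := by
      intro C N hC hN
      have e1 : (1 + ‖a‖) ^ N ≤ (1 + ‖a‖) ^ max N₁ N₂ := pow_le_pow_right₀ ha hN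
      have e2 : (1 + ‖u‖) ^ N ≤ (1 + ‖u‖) ^ max N₁ N₂ := pow_le_pow_right₀ hu hN
      have h0 : 0 ≤ C * ‖u‖ ^ 2 := by positivity
      exact mul_le_mul (mul_le_mul_of_nonneg_left e1 h0) e2 (by positivity) (by positivity)
    have hsplit : eval (a + u) (p + q) - eval a (p + q) - ∑ j, u j * eval a (pderiv j (p + q)) =
        (eval (a + u) p - eval a p - ∑ j, u j * eval a (pderiv j p)) +
          (eval (a + u) q - eval a q - ∑ j, u j * eval a (pderiv j q)) := by
      simp only [map_add, mul_add, Finset.sum_add_distrib]; ring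
    rw [hsplit]
    refine (norm_add_le _ _).trans ?_
    calc _ ≤ C₁ * ‖u‖ ^ 2 * (1 + ‖a‖) ^ max N₁ N₂ * (1 + ‖u‖) ^ max N₁ N₂ +
          C₂ * ‖u‖ ^ 2 * (1 + ‖a‖) ^ max N₁ N₂ * (1 + ‖u‖) ^ max N₁ N₂ :=
          add_le_add ((h₁ a u).trans (key hC₁ (le_max_left _ _)))
            ((h₂ a u).trans (key hC₂ (le_max_right _ _)))
      _ = (C₁ + C₂) * ‖u‖ ^ 2 * (1 + ‖a‖) ^ max N₁ N₂ * (1 + ‖u‖) ^ max N₁ N₂ := by ring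
  | mul_X p i hp =>
    obtain ⟨C, hC, N, h⟩ := hp
    obtain ⟨C₁, hC₁, N₁, h₁⟩ := exists_norm_eval_add_sub_eval_le p
    refine ⟨C + C₁, add_nonneg hC hC₁, max (N + 1) N₁, fun a u => ?_⟩
    set M := max (N + 1) N₁ with hM
    have ha : 1 ≤ 1 + ‖a‖ := le_add_of_nonneg_right (norm_nonneg _)
    have hu : 1 ≤ 1 + ‖u‖ := le_add_of_nonneg_right (norm_nonneg _)
    -- Leibniz: `∂ⱼ(p Xᵢ) = (∂ⱼ p) Xᵢ + p δᵢⱼ`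
    have hsum : ∑ j, u j * eval a (pderiv j (p * X i)) =
        (∑ j, u j * eval a (pderiv j p)) * a i + u i * eval a p := by
      have : ∀ j, u j * eval a (pderiv j (p * X i)) =
          u j * eval a (pderiv j p) * a i + (if j = i then u i * eval a p else 0) := by
        intro j
        rw [pderiv_mul, pderiv_X, map_add, map_mul, map_mul, eval_X]
        by_cases hji : j = i
        · subst hji; rw [if_pos rfl, Pi.single_eq_same, map_one]; ring
        · rw [if_neg hji, Pi.single_eq_of_ne (Ne.symm hji), map_zero]; ring
      simp only [this, Finset.sum_add_distrib, Finset.sum_ite_eq', Finset.mem_univ, if_true,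
        Finset.sum_mul]
    have eq : eval (a + u) (p * X i) - eval a (p * X i) - ∑ j, u j * eval a (pderiv j (p * X i)) =
        (eval (a + u) p - eval a p - ∑ j, u j * eval a (pderiv j p)) * a i +
          (eval (a + u) p - eval a p) * u i := by
      rw [hsum, map_mul, map_mul, eval_X, eval_X, Pi.add_apply]; ring
    rw [eq]
    have hai : ‖a i‖ ≤ (1 + ‖a‖) * (1 + ‖u‖) := by
      have h1 : ‖a i‖ ≤ ‖a‖ := norm_le_pi_norm a i
      nlinarith [norm_nonneg a, norm_nonneg u, norm_nonneg (a i)]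
    have hui : ‖u i‖ ≤ ‖u‖ := norm_le_pi_norm u i
    have t1 : ‖(eval (a + u) p - eval a p - ∑ j, u j * eval a (pderiv j p)) * a i‖ ≤
        C * ‖u‖ ^ 2 * (1 + ‖a‖) ^ M * (1 + ‖u‖) ^ M := by
      rw [norm_mul]
      calc _ ≤ (C * ‖u‖ ^ 2 * (1 + ‖a‖) ^ N * (1 + ‖u‖) ^ N) * ((1 + ‖a‖) * (1 + ‖u‖)) :=
            mul_le_mul (h a u) hai (norm_nonneg _) (by positivity)
        _ = C * ‖u‖ ^ 2 * (1 + ‖a‖) ^ (N + 1) * (1 + ‖u‖) ^ (N + 1) := by ring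
        _ ≤ C * ‖u‖ ^ 2 * (1 + ‖a‖) ^ M * (1 + ‖u‖) ^ M := by
            have e1 : (1 + ‖a‖) ^ (N + 1) ≤ (1 + ‖a‖) ^ M := pow_le_pow_right₀ ha (le_max_left _ _)
            have e2 : (1 + ‖u‖) ^ (N + 1) ≤ (1 + ‖u‖) ^ M := pow_le_pow_right₀ hu (le_max_left _ _)
            have h0 : 0 ≤ C * ‖u‖ ^ 2 := by positivity
            exact mul_le_mul (mul_le_mul_of_nonneg_left e1 h0) e2 (by positivity) (by positivity)
    have t2 : ‖(eval (a + u) p - eval a p) * u i‖ ≤ C₁ * ‖u‖ ^ 2 * (1 + ‖a‖) ^ M * (1 + ‖u‖) ^ M := by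
      rw [norm_mul]
      calc _ ≤ (C₁ * ‖u‖ * (1 + ‖a‖) ^ N₁ * (1 + ‖u‖) ^ N₁) * ‖u‖ :=
            mul_le_mul (h₁ a u) hui (norm_nonneg _) (by positivity)
        _ = C₁ * ‖u‖ ^ 2 * (1 + ‖a‖) ^ N₁ * (1 + ‖u‖) ^ N₁ := by ring
        _ ≤ C₁ * ‖u‖ ^ 2 * (1 + ‖a‖) ^ M * (1 + ‖u‖) ^ M := by
            have e1 : (1 + ‖a‖) ^ N₁ ≤ (1 + ‖a‖) ^ M := pow_le_pow_right₀ ha (le_max_right _ _)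
            have e2 : (1 + ‖u‖) ^ N₁ ≤ (1 + ‖u‖) ^ M := pow_le_pow_right₀ hu (le_max_right _ _)
            have h0 : 0 ≤ C₁ * ‖u‖ ^ 2 := by positivity
            exact mul_le_mul (mul_le_mul_of_nonneg_left e1 h0) e2 (by positivity) (by positivity)
    calc _ ≤ ‖(eval (a + u) p - eval a p - ∑ j, u j * eval a (pderiv j p)) * a i‖ +
          ‖(eval (a + u) p - eval a p) * u i‖ := norm_add_le _ _
      _ ≤ C * ‖u‖ ^ 2 * (1 + ‖a‖) ^ M * (1 + ‖u‖) ^ M +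
          C₁ * ‖u‖ ^ 2 * (1 + ‖a‖) ^ M * (1 + ‖u‖) ^ M := add_le_add t1 t2
      _ = (C + C₁) * ‖u‖ ^ 2 * (1 + ‖a‖) ^ M * (1 + ‖u‖) ^ M := by ring

/-- **Second-order expansion of a polynomial along a complex ray.** For `H ∈ ℂ[x₁..xₙ]` of total
degree `D ≥ 1` with homogeneous components `H_D`, `H_{D-1}` and `v ∈ ℂⁿ` there are `C ≥ 0`, `N` with
`‖H(τv + u) - τᴰ H_D(v) - τ^{D-1} (Σⱼ uⱼ (∂ⱼH_D)(v) + H_{D-1}(v))‖ ≤ C (1 + ‖u‖)ᴺ ‖τ‖^{D-1} / ‖τ‖` for all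
`τ ∈ ℂ`, `‖τ‖ ≥ 1`, `u ∈ ℂⁿ` (components of degree `≤ D - 2` contribute `O(‖τ‖^{D-2})`, the component of
degree `D - 1` its value at `v` plus `O(‖u‖ ‖τ‖^{D-2})`, the top one its first-order Taylor polynomial
plus `O(‖u‖² ‖τ‖^{D-2})`). [folklore] -/
theorem exists_norm_eval_ray_secondOrder_le {n : ℕ} (H : MvPolynomial (Fin n) ℂ) (hD : 1 ≤ H.totalDegree)
    (v : Fin n → ℂ) :
    ∃ C : ℝ, 0 ≤ C ∧ ∃ N : ℕ, ∀ τ : ℂ, 1 ≤ ‖τ‖ → ∀ u : Fin n → ℂ,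
      ‖eval (τ • v + u) H - τ ^ H.totalDegree * eval v (homogeneousComponent H.totalDegree H) -
          τ ^ (H.totalDegree - 1) * (∑ j, u j * eval v (pderiv j (homogeneousComponent H.totalDegree H)) +
            eval v (homogeneousComponent (H.totalDegree - 1) H))‖ ≤
        C * (1 + ‖u‖) ^ N * ‖τ‖ ^ (H.totalDegree - 1) / ‖τ‖ := by
  classical
  obtain ⟨D', hD'⟩ : ∃ D', H.totalDegree = D' + 1 := ⟨H.totalDegree - 1, by omega⟩
  set D := H.totalDegree with hDdef
  have hB : ∀ i : ℕ, ∃ C : ℝ, 0 ≤ C ∧ ∃ N : ℕ, ∀ z : Fin n → ℂ,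
      ‖eval z (homogeneousComponent i H)‖ ≤ C * (1 + ‖z‖) ^ N := fun i =>
    Literature.NumberTheory.Transcendental.HypersurfaceCover.exists_norm_eval_le_pow _
  choose B hB0 NB hBle using hB
  obtain ⟨CL, hCL0, NL, hL⟩ := exists_norm_eval_add_sub_eval_le (homogeneousComponent D' H)
  obtain ⟨CT, hCT0, NT, hT⟩ := exists_norm_eval_taylor_two_le (homogeneousComponent (D' + 1) H)
  set K : ℝ := 1 + ‖v‖ with hK
  have hK1 : 1 ≤ K := le_add_of_nonneg_right (norm_nonneg _)
  have hK0 : 0 ≤ K := zero_le_one.trans hK1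
  set Ntot : ℕ := (∑ i ∈ Finset.range D', NB i) + (NL + 1) + (NT + 2) with hNtot
  refine ⟨(∑ i ∈ Finset.range D', B i * K ^ NB i) + CL * K ^ NL + CT * K ^ NT,
    add_nonneg (add_nonneg (Finset.sum_nonneg fun i _ => mul_nonneg (hB0 i) (pow_nonneg hK0 _))
      (mul_nonneg hCL0 (pow_nonneg hK0 _))) (mul_nonneg hCT0 (pow_nonneg hK0 _)), Ntot, ?_⟩
  intro τ hτ u
  have hτpos : 0 < ‖τ‖ := by linarith
  have hτ0 : τ ≠ 0 := norm_pos_iff.mp hτpos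
  have hu1 : 1 ≤ 1 + ‖u‖ := le_add_of_nonneg_right (norm_nonneg _)
  set w : Fin n → ℂ := τ⁻¹ • u with hw
  have hwn : ‖w‖ = ‖u‖ / ‖τ‖ := by rw [hw, norm_smul, norm_inv, div_eq_inv_mul]
  have hwle : ‖w‖ ≤ ‖u‖ := by rw [hwn]; exact div_le_self (norm_nonneg _) hτ
  have hvw : 1 + ‖v + w‖ ≤ K * (1 + ‖u‖) := by
    have h1 := norm_add_le v w
    rw [hK]; nlinarith [norm_nonneg v, norm_nonneg u, norm_nonneg w]
  have hpowN : ∀ {N : ℕ}, N ≤ Ntot → ∀ {x : ℝ}, 1 ≤ x → x ^ N ≤ x ^ Ntot :=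
    fun hN x hx => pow_le_pow_right₀ hx hN
  -- decomposition `H(τv + u) = Σ_{i ≤ D} τⁱ Hᵢ(v + w)`, split as (i < D') + (i = D') + (i = D)
  have hdecomp : eval (τ • v + u) H =
      ∑ i ∈ Finset.range (D + 1), τ ^ i * eval (v + w) (homogeneousComponent i H) := by
    conv_lhs => rw [← sum_homogeneousComponent H]
    rw [map_sum]
    refine Finset.sum_congr rfl fun i _ => ?_
    have : τ • v + u = τ • (v + w) := by
      rw [hw, smul_add, smul_smul, mul_inv_cancel₀ hτ0, one_smul]
    rw [this, (homogeneousComponent_isHomogeneous i H).eval_smul_eq]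
  have hDm : D - 1 = D' := by omega
  rw [hdecomp, hD', Finset.sum_range_succ, Finset.sum_range_succ, Nat.add_sub_cancel]
  -- name the three error pieces
  set E₀ := ∑ i ∈ Finset.range D', τ ^ i * eval (v + w) (homogeneousComponent i H) with hE₀
  set E₁ := τ ^ D' * (eval (v + w) (homogeneousComponent D' H) - eval v (homogeneousComponent D' H))
    with hE₁
  set E₂ := τ ^ (D' + 1) * (eval (v + w) (homogeneousComponent (D' + 1) H) -
    eval v (homogeneousComponent (D' + 1) H) -
      ∑ j, w j * eval v (pderiv j (homogeneousComponent (D' + 1) H))) with hE₂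
  have hlin : τ ^ (D' + 1) * ∑ j, w j * eval v (pderiv j (homogeneousComponent (D' + 1) H)) =
      τ ^ D' * ∑ j, u j * eval v (pderiv j (homogeneousComponent (D' + 1) H)) := by
    rw [Finset.mul_sum, Finset.mul_sum]
    refine Finset.sum_congr rfl fun j _ => ?_
    simp only [hw, Pi.smul_apply, smul_eq_mul]
    rw [pow_succ]; field_simp
  have hrew : E₀ + τ ^ D' * eval (v + w) (homogeneousComponent D' H) +
      τ ^ (D' + 1) * eval (v + w) (homogeneousComponent (D' + 1) H) -
      τ ^ (D' + 1) * eval v (homogeneousComponent (D' + 1) H) -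
      τ ^ D' * (∑ j, u j * eval v (pderiv j (homogeneousComponent (D' + 1) H)) +
        eval v (homogeneousComponent D' H)) = E₀ + E₁ + E₂ := by
    rw [hE₁, hE₂]; linear_combination hlin
  rw [hrew]
  -- bounds
  have hE₀b : ‖E₀‖ ≤ (∑ i ∈ Finset.range D', B i * K ^ NB i) * (1 + ‖u‖) ^ Ntot * ‖τ‖ ^ D' / ‖τ‖ := by
    rw [hE₀]
    calc ‖∑ i ∈ Finset.range D', τ ^ i * eval (v + w) (homogeneousComponent i H)‖
        ≤ ∑ i ∈ Finset.range D', ‖τ ^ i * eval (v + w) (homogeneousComponent i H)‖ := norm_sum_le _ _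
      _ ≤ ∑ i ∈ Finset.range D', B i * K ^ NB i * (1 + ‖u‖) ^ Ntot * ‖τ‖ ^ D' / ‖τ‖ := by
          refine Finset.sum_le_sum fun i hi => ?_
          have hi' : i + 1 ≤ D' := by have := Finset.mem_range.mp hi; omega
          rw [norm_mul, norm_pow]
          have e1 : ‖τ‖ ^ i ≤ ‖τ‖ ^ D' / ‖τ‖ := by
            rw [le_div_iff₀ hτpos, ← pow_succ]
            exact pow_le_pow_right₀ hτ hi'
          have e2 : ‖eval (v + w) (homogeneousComponent i H)‖ ≤ B i * K ^ NB i * (1 + ‖u‖) ^ Ntot := by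
            refine (hBle i (v + w)).trans ?_
            have e3 : (1 + ‖v + w‖) ^ NB i ≤ (K * (1 + ‖u‖)) ^ NB i :=
              pow_le_pow_left₀ (by positivity) hvw _
            rw [mul_pow] at e3
            have e4 : (1 + ‖u‖) ^ NB i ≤ (1 + ‖u‖) ^ Ntot := by
              refine hpowN ?_ hu1
              have := Finset.single_le_sum (f := NB) (fun i _ => Nat.zero_le _) hi
              rw [hNtot]; omega
            calc B i * (1 + ‖v + w‖) ^ NB i ≤ B i * (K ^ NB i * (1 + ‖u‖) ^ NB i) :=
                  mul_le_mul_of_nonneg_left e3 (hB0 i)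
              _ ≤ B i * (K ^ NB i * (1 + ‖u‖) ^ Ntot) :=
                  mul_le_mul_of_nonneg_left (mul_le_mul_of_nonneg_left e4 (by positivity)) (hB0 i)
              _ = B i * K ^ NB i * (1 + ‖u‖) ^ Ntot := by ring
          calc ‖τ‖ ^ i * ‖eval (v + w) (homogeneousComponent i H)‖
              ≤ (‖τ‖ ^ D' / ‖τ‖) * (B i * K ^ NB i * (1 + ‖u‖) ^ Ntot) :=
                mul_le_mul e1 e2 (norm_nonneg _) (by positivity)
            _ = B i * K ^ NB i * (1 + ‖u‖) ^ Ntot * ‖τ‖ ^ D' / ‖τ‖ := by ring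
      _ = (∑ i ∈ Finset.range D', B i * K ^ NB i) * (1 + ‖u‖) ^ Ntot * ‖τ‖ ^ D' / ‖τ‖ := by
          rw [Finset.sum_mul, Finset.sum_mul, Finset.sum_div]
  have hE₁b : ‖E₁‖ ≤ CL * K ^ NL * (1 + ‖u‖) ^ Ntot * ‖τ‖ ^ D' / ‖τ‖ := by
    rw [hE₁, norm_mul, norm_pow]
    have e1 := hL v w
    have e2 : (1 + ‖w‖) ^ NL ≤ (1 + ‖u‖) ^ NL := pow_le_pow_left₀ (by positivity) (by linarith) _
    have e5 : ‖u‖ * (1 + ‖u‖) ^ NL ≤ (1 + ‖u‖) ^ Ntot := by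
      calc ‖u‖ * (1 + ‖u‖) ^ NL ≤ (1 + ‖u‖) * (1 + ‖u‖) ^ NL :=
            mul_le_mul_of_nonneg_right (by linarith) (by positivity)
        _ = (1 + ‖u‖) ^ (NL + 1) := by ring
        _ ≤ (1 + ‖u‖) ^ Ntot := hpowN (by rw [hNtot]; omega) hu1
    calc ‖τ‖ ^ D' * ‖eval (v + w) (homogeneousComponent D' H) - eval v (homogeneousComponent D' H)‖
        ≤ ‖τ‖ ^ D' * (CL * ‖w‖ * (1 + ‖v‖) ^ NL * (1 + ‖w‖) ^ NL) :=
          mul_le_mul_of_nonneg_left e1 (by positivity)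
      _ ≤ ‖τ‖ ^ D' * (CL * ‖w‖ * (1 + ‖v‖) ^ NL * (1 + ‖u‖) ^ NL) := by
          refine mul_le_mul_of_nonneg_left ?_ (by positivity)
          exact mul_le_mul_of_nonneg_left e2 (by positivity)
      _ = CL * K ^ NL * (‖u‖ * (1 + ‖u‖) ^ NL) * ‖τ‖ ^ D' / ‖τ‖ := by
          rw [hwn, hK]; field_simp
      _ ≤ CL * K ^ NL * (1 + ‖u‖) ^ Ntot * ‖τ‖ ^ D' / ‖τ‖ := by
          refine div_le_div_of_nonneg_right ?_ hτpos.le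
          refine mul_le_mul_of_nonneg_right ?_ (by positivity)
          exact mul_le_mul_of_nonneg_left e5 (by positivity)
  have hE₂b : ‖E₂‖ ≤ CT * K ^ NT * (1 + ‖u‖) ^ Ntot * ‖τ‖ ^ D' / ‖τ‖ := by
    rw [hE₂, norm_mul, norm_pow]
    have e1 := hT v w
    have e2 : (1 + ‖w‖) ^ NT ≤ (1 + ‖u‖) ^ NT := pow_le_pow_left₀ (by positivity) (by linarith) _
    have e3 : (1 + ‖v‖) ^ NT = K ^ NT := by rw [hK]
    have e4 : ‖τ‖ ^ (D' + 1) * ‖w‖ ^ 2 ≤ ‖τ‖ ^ D' / ‖τ‖ * ‖u‖ ^ 2 := by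
      rw [hwn, div_pow, pow_succ]
      have : ‖τ‖ ^ D' * ‖τ‖ * (‖u‖ ^ 2 / ‖τ‖ ^ 2) = ‖τ‖ ^ D' / ‖τ‖ * ‖u‖ ^ 2 := by
        field_simp
      rw [this]
    have e5 : ‖u‖ ^ 2 * (1 + ‖u‖) ^ NT ≤ (1 + ‖u‖) ^ Ntot := by
      calc ‖u‖ ^ 2 * (1 + ‖u‖) ^ NT ≤ (1 + ‖u‖) ^ 2 * (1 + ‖u‖) ^ NT :=
            mul_le_mul_of_nonneg_right (pow_le_pow_left₀ (norm_nonneg _) (by linarith) 2)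
              (by positivity)
        _ = (1 + ‖u‖) ^ (NT + 2) := by ring
        _ ≤ (1 + ‖u‖) ^ Ntot := hpowN (by rw [hNtot]; omega) hu1
    calc ‖τ‖ ^ (D' + 1) * ‖eval (v + w) (homogeneousComponent (D' + 1) H) -
          eval v (homogeneousComponent (D' + 1) H) -
            ∑ j, w j * eval v (pderiv j (homogeneousComponent (D' + 1) H))‖
        ≤ ‖τ‖ ^ (D' + 1) * (CT * ‖w‖ ^ 2 * (1 + ‖v‖) ^ NT * (1 + ‖w‖) ^ NT) :=
          mul_le_mul_of_nonneg_left e1 (by positivity)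
      _ ≤ ‖τ‖ ^ (D' + 1) * (CT * ‖w‖ ^ 2 * (1 + ‖v‖) ^ NT * (1 + ‖u‖) ^ NT) := by
          refine mul_le_mul_of_nonneg_left ?_ (by positivity)
          exact mul_le_mul_of_nonneg_left e2 (by positivity)
      _ = CT * K ^ NT * ((‖τ‖ ^ (D' + 1) * ‖w‖ ^ 2) * (1 + ‖u‖) ^ NT) := by rw [e3]; ring
      _ ≤ CT * K ^ NT * ((‖τ‖ ^ D' / ‖τ‖ * ‖u‖ ^ 2) * (1 + ‖u‖) ^ NT) := by
          refine mul_le_mul_of_nonneg_left ?_ (by positivity)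
          exact mul_le_mul_of_nonneg_right e4 (by positivity)
      _ = CT * K ^ NT * (‖u‖ ^ 2 * (1 + ‖u‖) ^ NT) * ‖τ‖ ^ D' / ‖τ‖ := by ring
      _ ≤ CT * K ^ NT * (1 + ‖u‖) ^ Ntot * ‖τ‖ ^ D' / ‖τ‖ := by
          refine div_le_div_of_nonneg_right ?_ hτpos.le
          refine mul_le_mul_of_nonneg_right ?_ (by positivity)
          exact mul_le_mul_of_nonneg_left e5 (by positivity)
  calc ‖E₀ + E₁ + E₂‖ ≤ ‖E₀‖ + ‖E₁‖ + ‖E₂‖ := norm_add₃_le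
    _ ≤ _ := add_le_add (add_le_add hE₀b hE₁b) hE₂b
    _ = ((∑ i ∈ Finset.range D', B i * K ^ NB i) + CL * K ^ NL + CT * K ^ NT) * (1 + ‖u‖) ^ Ntot *
        ‖τ‖ ^ D' / ‖τ‖ := by ring

end Summit.Schanuel.Schanuel.Theorems
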